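import Summits.QuantumFields.YangMills.Theorems.BalabanUVNodesN12TowerForestRanked
import Summits.QuantumFields.YangMills.Theorems.BalabanUVNodesN12BjCollarRoots
import Summits.QuantumFields.YangMills.Theorems.BalabanUVNodesN12TowerForestSlab
import HarnessLib

/-!
# BalabanUVNodes ∕ N12 — THE ROOT OF EVERY SITE IS THE CENTRE OF ITS LEAST ROOTED BLOCK, at the record's `𝐁_k(Z)`: the packaged ranked tower forest of `𝐁_k(Z)` with roots, words,
# true displacements, tower confinement, (ROOTBLK) and ★ (CENTRE): for a site `z` of `Γ_J`, `root z` is the centre of the `(J−1)`-block of `z` when that block is an end of a member `(J−1)`-bond (the face layer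
# of a boundary block), and the centre of the `J`-block of `z` otherwise — dag-n12-w6's Q2-DESIGN §1∕§8 reading «roots = block CENTRES», «`B^{j−1}(p̃)` hangs from `p`, the rest of
# `B^j(x)` from `r`» as a theorem

Cell `pub-ymgap` (HUMAN RULINGS D-0062 ∕ D-0149), WIDTH SEAT `pub-ymgap-dag-n12-w3` g3 (node N12 = [B15]; key K1⁹ `stmt-QuantumFields-27364` (KEY MAP v2), `--kind proof --supports … --as
helper`; count-neutral).  THEOREMS ONLY (0 `def`, 0 `instance`, 0 `sorry`); consumed BY NAME: this seat's `N12TowerForestRanked.exists_towerForest_ranked` ∕ `root_eq_root_of_parent` ∕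
`root_eq_of_walk`, `N12BjCollarRoots.rootPoint_classification` ∕ `root_eq_centre_pred_of_rooted` ∕ `mem_maxDomT_pred_of_blockIdx` ∕ `mem_maxDomT_of_iterBlockOf_mem_Bj` ∕
`not_mem_maxDomT_of_iterBlockOf_mem_Bj` ∕ `mem_maxDomT_iff_of_iterBlockOf_eq` ∕ `eq_of_iterBlockOf_mem_Bj` ∕ `idx_adj_of_bond`, `N12TowerForestSlab.faceLayer_of_step` (the slab lemma),
`N12TowerForestWords.exists_root_walk_word` ∕ `iterBlockOf_root_eq_of_confined` ∕ `walk_singleton_of_step`, `N12FlatHndRecordLetters.hcov_Bj`, `N12FlatHndHarmonicLetter.not_wrap_of_iterBlockOf_shift_eq`.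

HONEST FRAMING.  Lattice bookkeeping by name; no analysis; nothing of Bałaban's asserted; N12 NOT discharged; K1⁹ NOT closed; counts unmoved (typed 28∕28 · discharged 5∕27);
one finite 𝕋⁴ programme at fixed ε — R4 closes the conditional rung `BalabanLadder.UV` only; the Yang–Mills mass gap (Clay) is NOT proved by any of this; nothing continuum ∕ ℝ⁴ ∕ OS.
-/

noncomputable section

namespace Summit.QuantumFields.YangMills.BalabanUVNodes.N12TowerForestRootsBj

open scoped BigOperators
open Literature.MathematicalPhysics.QuantumFieldTheory.Balaban1983to89
open T4Continuum
open B15DeterminingSets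
open B5Eq118OneStroke (iterBlockOf iterBlockOf_succ val_iterBlockOf)
open B14.Eq213MaximalDomains (side)
open B14.Eq213DetSet (Bj Bj_zero Bj_mid Bj_top Bj_of_gt maxDomT maxDomT_antitone)
open Literature.MathematicalPhysics.QuantumFieldTheory.BalabanImbrieJaffe1984to88.BIJ88RT51Background (iterBlockOf_embIter)
open Summit.QuantumFields.YangMills.BalabanUVNodes.N12FlatHndRecordLetters (hcov_Bj)
open Summit.QuantumFields.YangMills.BalabanUVNodes.N12FlatHndHarmonicLetter (not_wrap_of_iterBlockOf_shift_eq)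
open Summit.QuantumFields.YangMills.BalabanUVNodes.N07CritMultiScaleLamBond (iterBlockOf_congr_of_le)
open Summit.QuantumFields.YangMills.BalabanUVNodes.N12TowerForestWords (exists_root_walk_word)
open Summit.QuantumFields.YangMills.BalabanUVNodes.N12TowerForestRanked (exists_towerForest_ranked root_eq_root_of_parent)
open Summit.QuantumFields.YangMills.BalabanUVNodes.N12TowerForestSlab (faceLayer_of_step)
open Summit.QuantumFields.YangMills.BalabanUVNodes.N12BjCollarRoots

variable {P : Params}

/-! ## The rooted tower forest of `𝐁_k(Z)`: the root of every site is the centre of its least rooted block -/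

section Rooted

/-- ★★★ **THE ROOTED TOWER FOREST OF THE RECORD's `𝐁_k(Z)` — ROOTS ARE BLOCK CENTRES, AND WHICH ONES** (`1 ≤ k ≤ m + K`, `M₁ ≥ 2`, cover divisibility): a rooted forest `path` of the
fine torus with root set `R(𝐁_k(Z), k)` and its root map `root`, with (F1), (F2), (TREE), `root r = r` on `R`, every path the walk of its letter word from its root, and for every ROOTED
level `j ≤ k` of a site (`ι_j(B^j z) ∈ R`): (TOWER) the path stays in the `j`-block, (LEN) `|path z| ≤ Σ_{i≤j}(d(Lⁱ−1)∕2+1)`, (DISP) the true integer displacement, (ROOTBLK)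
`B^j(root z) = B^j z`; (Cov) every site has a member level `J ≤ k` (`B^J z ∈ 𝐁_k(Z)_J`, its `Γ`-level, unique by `N12BjCollarRoots.eq_of_iterBlockOf_mem_Bj`); and ★ (CENTRE): for a site
`z` of `Γ`-level `J`, IF `J ≥ 1` and the `(J−1)`-block of `z` is an end of a member `(J−1)`-bond (the face layer of a boundary block) THEN `root z = ι_{J−1}(B^{J−1} z)`, ELSE
`root z = ι_J(B^J z)` — the centre of the least rooted block, dag-n12-w6's «roots = block CENTRES ∕ `B^{j−1}(p̃)` hangs from `p`, the rest of `B^j(x)` from `r`».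
[cite: Balaban1988Convergent, (2.2) p.255, (2.13) pp.256–257; Balaban1985Variational, (3)–(4) p.278, (16)–(18) p.280; Balaban1985RegularSpaces, (1.19) p.79; Balaban1987RG1, (0.1)–(0.3) pp.251–252] -/
theorem exists_towerForest_rooted_Bj {k M₁ : ℕ} {Z : Set (Site P 0)} (hk : k ≤ P.m + P.K) (hk1 : 1 ≤ k) (hM2 : 2 ≤ M₁) (hdiv : side P.L M₁ k ∣ P.sitesPerDir 0) :
    ∃ (path : Site P 0 → List (LStep P 0)) (root : Site P 0 → Site P 0),
      (∀ x, ∀ s ∈ path x, ∃ x' x'' : Site P 0, path x'' = path x' ++ [s] ∧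
        (s.fwd = true → s.bond.src = x' ∧ s.bond.tgt = x'') ∧ (s.fwd = false → s.bond.src = x'' ∧ s.bond.tgt = x')) ∧
      (∀ j, j ≤ k → ∀ c ∈ bondsOf ((Bj M₁ Z k : DetSet P) j), path (embIter j c.src) = [] ∧ path (embIter j c.tgt) = []) ∧
      (∀ x : Site P 0, x ∉ {z : Site P 0 | ∃ j, j ≤ k ∧ ∃ c ∈ bondsOf ((Bj M₁ Z k : DetSet P) j), (z = embIter j c.src ∨ z = embIter j c.tgt)} →
        ∃ (x' : Site P 0) (s : LStep P 0), path x = path x' ++ [s] ∧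
          (s.fwd = true → s.bond.src = x' ∧ s.bond.tgt = x) ∧ (s.fwd = false → s.bond.src = x ∧ s.bond.tgt = x')) ∧
      (∀ r ∈ {z : Site P 0 | ∃ j, j ≤ k ∧ ∃ c ∈ bondsOf ((Bj M₁ Z k : DetSet P) j), (z = embIter j c.src ∨ z = embIter j c.tgt)}, root r = r) ∧
      (∀ x : Site P 0, root x ∈ {z : Site P 0 | ∃ j, j ≤ k ∧ ∃ c ∈ bondsOf ((Bj M₁ Z k : DetSet P) j), (z = embIter j c.src ∨ z = embIter j c.tgt)} ∧
        path x = walk (root x) ((path x).map fun s => (s.bond.dir, s.fwd)) ∧ walkEnd (root x) ((path x).map fun s => (s.bond.dir, s.fwd)) = x) ∧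
      (∀ (z : Site P 0) (j : ℕ), j ≤ k →
        embIter j (iterBlockOf j z) ∈ {z : Site P 0 | ∃ j, j ≤ k ∧ ∃ c ∈ bondsOf ((Bj M₁ Z k : DetSet P) j), (z = embIter j c.src ∨ z = embIter j c.tgt)} →
        (∀ s ∈ path z, iterBlockOf j s.bond.src = iterBlockOf j z ∧ iterBlockOf j s.bond.tgt = iterBlockOf j z) ∧
        (path z).length ≤ ∑ i ∈ Finset.range (j + 1), (P.d * ((P.L ^ i - 1) / 2) + 1) ∧
        (∀ ν, netDisp ((path z).map fun s => (s.bond.dir, s.fwd)) ν = ((z ν).val : ℤ) - ((root z ν).val : ℤ)) ∧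
        iterBlockOf j (root z) = iterBlockOf j z) ∧
      (∀ z : Site P 0, ∃ J, J ≤ k ∧ iterBlockOf J z ∈ (Bj M₁ Z k : DetSet P) J) ∧
      (∀ (z : Site P 0) (J : ℕ), iterBlockOf J z ∈ (Bj M₁ Z k : DetSet P) J →
        ((1 ≤ J ∧ ∃ c ∈ bondsOf ((Bj M₁ Z k : DetSet P) (J - 1)), (iterBlockOf (J - 1) z = c.src ∨ iterBlockOf (J - 1) z = c.tgt)) ∧
            root z = embIter (J - 1) (iterBlockOf (J - 1) z)) ∨
        (¬ (1 ≤ J ∧ ∃ c ∈ bondsOf ((Bj M₁ Z k : DetSet P) (J - 1)), (iterBlockOf (J - 1) z = c.src ∨ iterBlockOf (J - 1) z = c.tgt)) ∧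
            root z = embIter J (iterBlockOf J z))) := by
  classical
  have hM : 1 ≤ M₁ := by omega
  set R : Set (Site P 0) := {z : Site P 0 | ∃ j, j ≤ k ∧ ∃ c ∈ bondsOf ((Bj M₁ Z k : DetSet P) j), (z = embIter j c.src ∨ z = embIter j c.tgt)} with hR
  have hcov := hcov_Bj hM hk1 hk hdiv (Z := Z)
  obtain ⟨path, nz, hnz, hF1, hF2m, hF2, hPAR, hTOWER, hLEN⟩ := exists_towerForest_ranked (Bj M₁ Z k) hk hcov
  have htree : ∀ x : Site P 0, x ∉ R → ∃ (x' : Site P 0) (s : LStep P 0), path x = path x' ++ [s] ∧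
      (s.fwd = true → s.bond.src = x' ∧ s.bond.tgt = x) ∧ (s.fwd = false → s.bond.src = x ∧ s.bond.tgt = x') := fun x hx => by
    obtain ⟨x', s, hpx, hor, -⟩ := hPAR x hx
    exact ⟨x', s, hpx, hor⟩
  obtain ⟨root, hrootR, hw⟩ := exists_root_walk_word hF2 htree
  -- membership of centres in `R`
  have hmemJ : ∀ {z : Site P 0} {J : ℕ}, iterBlockOf J z ∈ (Bj M₁ Z k : DetSet P) J → embIter J (iterBlockOf J z) ∈ R := fun {z J} hz =>
    ⟨J, le_of_iterBlockOf_mem_Bj hz, ⟨iterBlockOf J z, ⟨0, P.hd⟩⟩, Or.inl hz, Or.inl rfl⟩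
  have hmemFL : ∀ {z : Site P 0} {J : ℕ}, J ≤ k → ∀ c ∈ bondsOf ((Bj M₁ Z k : DetSet P) J),
      (iterBlockOf J z = c.src ∨ iterBlockOf J z = c.tgt) → embIter J (iterBlockOf J z) ∈ R := fun {z J} hJ c hc h =>
    ⟨J, hJ, c, hc, by rcases h with h | h <;> [exact Or.inl (by rw [h]); exact Or.inr (by rw [h])]⟩
  refine ⟨path, root, hF1, hF2m, htree, hrootR, fun x => ⟨(hw x).1, (hw x).2.1, (hw x).2.2.1⟩, fun z j hj hmem =>
    ⟨hTOWER z j hj hmem, hLEN z j hj hmem, ?_, N12TowerForestWords.iterBlockOf_root_eq_of_confined (hw z).2.1 (hw z).2.2.1 (hTOWER z j hj hmem)⟩, hcov, ?_⟩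
  · -- (DISP): no step of `path z` wraps, both ends of every step lying in the `j`-block of `z`
    refine (hw z).2.2.2 fun s hs => ?_
    obtain ⟨hsrc, htgt⟩ := hTOWER z j hj hmem s hs
    exact not_wrap_of_iterBlockOf_shift_eq (hj.trans hk) s.bond.src s.bond.dir (htgt.trans hsrc.symm)
  -- (CENTRE)
  intro z J hz
  have hJk := le_of_iterBlockOf_mem_Bj hz
  by_cases hFL : 1 ≤ J ∧ ∃ c ∈ bondsOf ((Bj M₁ Z k : DetSet P) (J - 1)), (iterBlockOf (J - 1) z = c.src ∨ iterBlockOf (J - 1) z = c.tgt)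
  · -- the face layer: (ROOTBLK) at the levels `J − 1`, `J` and `N12BjCollarRoots.root_eq_centre_pred_of_rooted`
    left
    obtain ⟨hJ1, c, hc, hcz⟩ := hFL
    refine ⟨⟨hJ1, c, hc, hcz⟩, ?_⟩
    have hblk : iterBlockOf (J - 1) (root z) = iterBlockOf (J - 1) z :=
      N12TowerForestWords.iterBlockOf_root_eq_of_confined (hw z).2.1 (hw z).2.2.1 (hTOWER z (J - 1) (by omega) (hmemFL (by omega) c hc hcz))
    have hblkJ : iterBlockOf J (root z) = iterBlockOf J z :=
      N12TowerForestWords.iterBlockOf_root_eq_of_confined (hw z).2.1 (hw z).2.2.1 (hTOWER z J hJk (hmemJ hz))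
    exact root_eq_centre_pred_of_rooted hM2 hdiv hk hJ1 hz (hw z).1 hblkJ hblk
  · right
    refine ⟨hFL, ?_⟩
    -- off the face layer: induction along the path, the slab lemma excluding a face-layer parent
    have key : ∀ (n : ℕ) (z : Site P 0), (path z).length = n → ∀ J, iterBlockOf J z ∈ (Bj M₁ Z k : DetSet P) J →
        ¬ (1 ≤ J ∧ ∃ c ∈ bondsOf ((Bj M₁ Z k : DetSet P) (J - 1)), (iterBlockOf (J - 1) z = c.src ∨ iterBlockOf (J - 1) z = c.tgt)) →
        root z = embIter J (iterBlockOf J z) := by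
      intro n
      induction' n using Nat.strong_induction_on with n ih
      intro z hn J hz hFL
      have hJk := le_of_iterBlockOf_mem_Bj hz
      by_cases hzR : z ∈ R
      · -- a root point of a `Γ_J`-block off the face layer is the block's centre
        rw [hrootR z hzR]
        rcases rootPoint_classification hM2 hdiv hk hz hzR rfl with h | ⟨hJ1, -, c, hc, hcz⟩
        · exact h
        · exact absurd ⟨hJ1, c, hc, hcz⟩ hFL
      · obtain ⟨z', s, hpz, hor, hE, hnle, hdist1⟩ := hPAR z hzR
        have hrr : root z = root z' := root_eq_root_of_parent hpz hor (hw z).2.1 (hw z).2.2.1 (hw z').2.1 (hw z').2.2.1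
        have hblkJ : iterBlockOf J z' = iterBlockOf J z := hE J hJk (hmemJ hz)
        have hz' : iterBlockOf J z' ∈ (Bj M₁ Z k : DetSet P) J := by rw [hblkJ]; exact hz
        have hlt : (path z').length < n := by rw [← hn, hpz, List.length_append, List.length_singleton]; omega
        by_cases hFL' : 1 ≤ J ∧ ∃ c ∈ bondsOf ((Bj M₁ Z k : DetSet P) (J - 1)), (iterBlockOf (J - 1) z' = c.src ∨ iterBlockOf (J - 1) z' = c.tgt)
        · -- a face-layer parent forces a face-layer child: contradiction
          exfalso
          have hJ1 : 1 ≤ J := hFL'.1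
          -- the least root level of `z` is `≤ J`; if it is `≤ J − 1` the `(J−1)`-blocks of `z`, `z′` agree
          have hnzJ : nz z ≤ J := (hnz z).2.2 J hJk (hmemJ hz)
          rcases hnzJ.lt_or_eq with hlt' | heq
          · obtain ⟨-, c, hc, hcz'⟩ := hFL'
            have hb : iterBlockOf (J - 1) z' = iterBlockOf (J - 1) z :=
              iterBlockOf_congr_of_le (by omega : nz z ≤ J - 1) (hE (nz z) (hnz z).1 (hnz z).2.1)
            exact hFL ⟨hJ1, c, hc, by rw [← hb]; exact hcz'⟩
          · -- least root level `J`: the parent is one unit closer to the centre of the `J`-block — the slab lemma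
            obtain ⟨n', hn'⟩ : ∃ n', J = n' + 1 := ⟨J - 1, by omega⟩
            subst hn'
            have hFL'' : 1 ≤ n' + 1 ∧ ∃ c ∈ bondsOf ((Bj M₁ Z k : DetSet P) n'), (iterBlockOf n' z' = c.src ∨ iterBlockOf n' z' = c.tgt) := hFL'
            change ¬ (1 ≤ n' + 1 ∧ ∃ c ∈ bondsOf ((Bj M₁ Z k : DetSet P) n'), (iterBlockOf n' z = c.src ∨ iterBlockOf n' z = c.tgt)) at hFL
            obtain ⟨-, c, hc, hcz'⟩ := hFL''
            have hdist' : Site.tdist z' (embIter (n' + 1) (iterBlockOf (n' + 1) z)) + 1 = Site.tdist z (embIter (n' + 1) (iterBlockOf (n' + 1) z)) := by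
              rw [heq] at hdist1; exact hdist1
            have hstep : walkEnd z' [(s.bond.dir, s.fwd)] = z := (N12TowerForestWords.walk_singleton_of_step hor).2
            -- the member end `y₀ ∈ 𝐁_{n′}` of `c`, adjacent to `B^{n′} z′` (which is NOT a member: `z′` has `Γ`-level `n′ + 1`)
            have hnot : iterBlockOf n' z' ∉ (Bj M₁ Z k : DetSet P) n' := fun h =>
              absurd (eq_of_iterBlockOf_mem_Bj hM hdiv hk h hz') (by omega)
            obtain ⟨y₀, hy₀mem, hadj⟩ : ∃ y₀ : Site P n', y₀ ∈ (Bj M₁ Z k : DetSet P) n' ∧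
                (y₀ = (iterBlockOf n' z').shift c.dir ∨ iterBlockOf n' z' = y₀.shift c.dir) := by
              rcases hc with hsrc | htgt <;> rcases hcz' with h | h
              · exact absurd (h ▸ hsrc) hnot
              · exact ⟨c.src, hsrc, Or.inr h⟩
              · exact ⟨c.tgt, htgt, Or.inl (by rw [h]; rfl)⟩
              · exact absurd (h ▸ htgt) hnot
            -- `y₀`'s `(n′+1)`-block is not the block of `z` (its centre lies outside `Ω_{n′+1}`)
            have hx₀ : iterBlockOf n' (embIter n' y₀) = y₀ := iterBlockOf_embIter n' (by omega) y₀
            have hx₀mem : iterBlockOf n' (embIter n' y₀) ∈ (Bj M₁ Z k : DetSet P) n' := by rw [hx₀]; exact hy₀mem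
            have hx₀out : embIter n' y₀ ∉ maxDomT M₁ Z (n' + 1) :=
              not_mem_maxDomT_of_iterBlockOf_mem_Bj hM hdiv hk (Nat.lt_succ_self n') hJk hx₀mem
            have hzΩ : z ∈ maxDomT M₁ Z (n' + 1) := mem_maxDomT_of_iterBlockOf_mem_Bj hM hdiv hk hJ1 hz
            have hout : blockOf y₀ ≠ iterBlockOf (n' + 1) z := fun h => hx₀out <|
              (mem_maxDomT_iff_of_iterBlockOf_eq hM hdiv hk hJ1 hJk le_rfl (show iterBlockOf (n' + 1) (embIter n' y₀) = iterBlockOf (n' + 1) z by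
                rw [iterBlockOf_succ, hx₀, h])).2 hzΩ
            -- THE SLAB LEMMA: `B^{n′} z` has a neighbour `y₁` in `y₀`'s `(n′+1)`-block
            obtain ⟨y₁, hadj₁, hblk₁⟩ := faceLayer_of_step (by omega) hstep hblkJ hdist' hadj hout
            -- `y₁ ∈ 𝐁_{n′}`: outside `Ω_{n′+1}` (same `(n′+1)`-block as `y₀`), inside `Ω_{n′}` by the collar (adjacent to `B^{n′} z`, `z ∈ Ω_{n′+1}`)
            have hx₁ : iterBlockOf n' (embIter n' y₁) = y₁ := iterBlockOf_embIter n' (by omega) y₁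
            have hx₁out : embIter n' y₁ ∉ maxDomT M₁ Z (n' + 1) := fun h => hx₀out <|
              (mem_maxDomT_iff_of_iterBlockOf_eq hM hdiv hk hJ1 hJk le_rfl (show iterBlockOf (n' + 1) (embIter n' y₀) = iterBlockOf (n' + 1) (embIter n' y₁) by
                rw [iterBlockOf_succ, iterBlockOf_succ, hx₀, hx₁, hblk₁])).2 h
            have hadjκ : ∀ κ, iterBlockOf n' (embIter n' y₁) κ = iterBlockOf n' z κ ∨ iterBlockOf n' (embIter n' y₁) κ = iterBlockOf n' z κ + 1 ∨
                iterBlockOf n' z κ = iterBlockOf n' (embIter n' y₁) κ + 1 := by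
              rw [hx₁]
              rcases hadj₁ with h | h
              · exact idx_adj_of_bond ⟨iterBlockOf n' z, c.dir⟩ (y := iterBlockOf n' z) (y₀ := y₁) (Or.inl rfl) (Or.inr h)
              · exact idx_adj_of_bond ⟨y₁, c.dir⟩ (y := iterBlockOf n' z) (y₀ := y₁) (Or.inr h) (Or.inl rfl)
            have hy₁mem : y₁ ∈ (Bj M₁ Z k : DetSet P) n' := by
              rcases Nat.eq_zero_or_pos n' with hn0 | hn0
              · subst hn0
                rw [Bj_zero (by omega)]
                exact hx₁out
              · have hx₁in : embIter n' y₁ ∈ maxDomT M₁ Z n' := by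
                  have := mem_maxDomT_pred_of_blockIdx hM2 hdiv hk hJ1 hJk (Nat.le_succ n') hzΩ hadjκ
                  rwa [Nat.add_sub_cancel] at this
                rw [Bj_mid hn0 (by omega)]
                exact ⟨mem_pts.2 hx₁in, fun h => hx₁out (mem_pts.1 h)⟩
            -- hence `z` is in the face layer after all
            refine hFL ⟨hJ1, ?_⟩
            rcases hadj₁ with h | h
            · exact ⟨⟨iterBlockOf n' z, c.dir⟩, Or.inr (by rw [PBond.tgt, ← h]; exact hy₁mem), Or.inl rfl⟩
            · exact ⟨⟨y₁, c.dir⟩, Or.inl hy₁mem, Or.inr h⟩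
        · rw [hrr, ih _ hlt z' rfl J hz' hFL', hblkJ]
    exact key _ z rfl J hz hFL

end Rooted

end Summit.QuantumFields.YangMills.BalabanUVNodes.N12TowerForestRootsBj

end
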